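import Summits.QuantumFields.YangMills.Theorems.DiagonalMirrorRPRCubeSurgeryDefs
import Summits.QuantumFields.YangMills.Theorems.DiagonalMirrorRPRWilsonDiagonalModelMirrorFamily
import Literature.MathematicalPhysics.QuantumFieldTheory.ConstructiveQFTWave0Proofs

/-!
# Crux `WeakCouplingHypercubicLimitRP` (stmt-QuantumFields-27398), line `Sketch`, door C (`cube-surgery-decoupling`):
# the SEAM INTERPOLATION — boundary conditions between the free cube and the torus, one-plaquette influences,
# and the quantitative letter `SeamInfluenceDecay` (Defs)

Definitions file (`--supports stmt-QuantumFields-27398 --as helper`) of the crux lead `lead-27398-D1` g3 (docket director-ym g24,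
O4 WORD 37 internal plan (p2) «door-C interpolation piece toward `AdmissibleCubeDecoupling`»; typing prices idea-crit-9 g13
p-C1/p-C2/p-C3, o4 INBOX l.414).  Door C's letter `CubeDecoupling r sch R` (✓ `…DiagonalMirrorRPRCubeSurgeryDefs` :150) compares the
swap Gram pairing of a reflected family under Wilson's torus measure and under the FREE-CUBE measure `cubeMeasure` (plaquettes leaving
`Q_R` deleted).  The interpolation between the two is DISCRETE and EXACT (no coupling-constant calculus): re-insert the deleted
plaquettes one at a time.

* `plaqCost ρ p U = N − Re tr ρ(U_p)` (one plaquette's Wilson cost; `= N − plaqRe ρ U p`);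
* `seamAction ρ A U = ∑_{p ∈ A} plaqCost ρ p U` for a finite set `A` of plaquettes (the re-inserted ones);
* `seam S R` = the plaquettes of the torus of side `S` NOT in the free cube `Q_R` (for the intended extreme instance `R = L`, `S = 2L+1`
  (p-C3) these are exactly the plaquettes that WRAP around the torus);
* `seamMeasure ρ β S R A` = product Haar tilted by `−β (S_{Q_R} + seamAction A)` — Wilson's measure of the cube with the plaquettes of `A`
  re-inserted («boundary condition `A`»); `A = ∅` is `cubeMeasure`, `A = seam S R` is `wilsonMeasure` (companion file);
* `seamInfluence ρ β S R A p Φ = Cov_{ν_A}(Φ, e^{−β plaqCost p}) / E_{ν_A}[e^{−β plaqCost p}]` — the ONE-PLAQUETTE BOUNDARY INFLUENCE of `p`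
  on the observable `Φ` under boundary condition `A`; it EQUALS `E_{ν_{A ∪ {p}}}[Φ] − E_{ν_A}[Φ]` (companion file), so that along any
  enumeration `l` of the seam `E_torus[Φ] − E_cube[Φ] = seamSum … Φ l` (telescoping; `seamSum` below) — a finite-`k` IDENTITY;
* `swapProduct r sch F k` — the integrand `Y_k(F)(Σ Ũ) · Y_k(F)(Ũ)` common to `gramPairing` and `cubeGramPairing`
  (✓`gramPairing_eq_integral_famObs_swap`, ✓`cubeGramPairing_eq_integral_famObs_swap`);
* the quantitative LETTER `SeamInfluenceDecay r sch R m` (p-C2: finite-`k`, rate explicit in `(a_k, R_k, c_k, dist)`): uniformly over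
  intermediate boundary conditions `A ⊆ seam`, the one-plaquette influence of a seam plaquette on the renormalised family product is
  `≤ K · (a_k⁻¹)^P · e^{−m (a_k R_k − D)}` eventually (`K, D, P` depending on the family: `(a_k⁻¹)^P` carries the renormalisation growth
  `c_k²`, `D` the physical support radius, `a_k R_k − D` the physical distance from the supports to the seam, `m > 0` a physical mass).

Why the letter might be TRUE in print-covered regimes: strong coupling (Osterwalder–Seiler 1978 §3–4 cluster expansion: exponential decay of
boundary influences uniformly in boundary conditions), finite `G` at large `β` (Adhikari–Cao, arXiv:2202.10375 Thm 1).  Why it may FAIL where the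
crux lives (non-abelian `G`, `d = 4`, weak coupling): it is infinite-volume LOCALITY of the weak-coupling limit in physical units, uniform in
boundary conditions — wall W-loc of record (g13 16:49Z); strictly MORE than `CubeDecoupling` (a `Tendsto`), hence located-falsifiable at finite `k`.

HONEST FRAMING: vocabulary only; `SeamInfluenceDecay` is a PREDICATE (the line's door-C quantitative letter), not a cited fact and not a
registered obligation.  D1′, the crux ⟨27398⟩, its heart S6i and the summit are OPEN; the Yang–Mills mass gap is NOT proved here or anywhere in
the tree.  No instance, no notation, `autoImplicit false`.

References: Osterwalder–Seiler, Ann. Phys. 110 (1978) §2–4; Seiler, LNP 159 (1982) Ch. 2; Georgii, Gibbs Measures (2011) Def. 2.9 (tilted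
/ Gibbsian reweighting); A. Adhikari, S. Cao, arXiv:2202.10375 Thm 1.
-/

set_option autoImplicit false

noncomputable section

open MeasureTheory Filter Topology
open Literature.MathematicalPhysics.QuantumLattice Literature.MathematicalPhysics.AQFT
  Literature.MathematicalPhysics.QuantumFieldTheory
open Summit.QuantumFields.YangMills.Cruxes.DiagonalMirrorRPR.SignTwistedDiagonalTrace (ReflectedFamily gramPairing famObs)

namespace Summit.QuantumFields.YangMills.Cruxes.DiagonalMirrorRPR.CubeSurgery

/-! ## §1 Boundary conditions between the free cube and the torus -/

section Seam

variable {G : Type} [Group G]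

/-- The Wilson cost of one plaquette, `N − Re tr ρ(U_p)`. -/
def plaqCost {N : ℕ} (ρ : G →* Matrix (Fin N) (Fin N) ℂ) {S : ℕ} (p : Plaquette 4 S) (U : GaugeConfig 4 S G) : ℝ :=
  (N : ℝ) - (ρ (plaquetteHolonomy U p.1 p.2.1.1 p.2.1.2)).trace.re

/-- The action of a finite set `A` of (re-inserted) plaquettes: `∑_{p ∈ A} (N − Re tr ρ(U_p))`. -/
def seamAction {N : ℕ} (ρ : G →* Matrix (Fin N) (Fin N) ℂ) {S : ℕ} (A : Finset (Plaquette 4 S)) (U : GaugeConfig 4 S G) : ℝ :=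
  ∑ p ∈ A, plaqCost ρ p U

open Classical in
/-- The SEAM of the free cube `Q_R` inside the torus of side `S`: the plaquettes NOT in the cube (the deleted ones).  For the
intended extreme instance `R = L`, `S = 2L+1` these are exactly the plaquettes wrapping around the torus. -/
def seam (S R : ℕ) [NeZero S] : Finset (Plaquette 4 S) :=
  Finset.univ.filter fun p => ¬ PlaqInCube S R p

variable [TopologicalSpace G] [IsTopologicalGroup G] [CompactSpace G] [MeasurableSpace G] [BorelSpace G]

/-- **Wilson's measure of the free cube with the plaquettes of `A` re-inserted** (boundary condition `A`): product Haar measure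
tilted (Gibbs-reweighted and normalised, Mathlib `Measure.tilted`) by `−β (S_{Q_R} + ∑_{p ∈ A} (N − Re tr ρ(U_p)))`. -/
def seamMeasure {N : ℕ} (ρ : G →* Matrix (Fin N) (Fin N) ℂ) (β : ℝ) (S R : ℕ) [NeZero S] (A : Finset (Plaquette 4 S)) :
    Measure (GaugeConfig 4 S G) :=
  (Measure.pi fun _ : Edge 4 S => haarProbability G).tilted fun U => -β * (cubeAction ρ S R U + seamAction ρ A U)

/-- **The one-plaquette boundary influence** of the plaquette `p` on the observable `Φ` under boundary condition `A`:
`Cov_{ν_A}(Φ, w_p) / E_{ν_A}[w_p]` with `w_p = e^{−β (N − Re tr ρ(U_p))}` and `ν_A = seamMeasure ρ β S R A`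
(`= E_{ν_{A ∪ {p}}}[Φ] − E_{ν_A}[Φ]` for `p ∉ A`, companion file). -/
def seamInfluence {N : ℕ} (ρ : G →* Matrix (Fin N) (Fin N) ℂ) (β : ℝ) (S R : ℕ) [NeZero S] (A : Finset (Plaquette 4 S))
    (p : Plaquette 4 S) (Φ : GaugeConfig 4 S G → ℝ) : ℝ :=
  ((∫ U, Φ U * Real.exp (-β * plaqCost ρ p U) ∂(seamMeasure ρ β S R A)) -
      (∫ U, Φ U ∂(seamMeasure ρ β S R A)) * (∫ U, Real.exp (-β * plaqCost ρ p U) ∂(seamMeasure ρ β S R A))) /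
    ∫ U, Real.exp (-β * plaqCost ρ p U) ∂(seamMeasure ρ β S R A)

/-- The telescoping sum of one-plaquette influences along a list of plaquettes (the head is inserted LAST):
`seamSum [p₁, …, p_M] = ∑_i influence(boundary condition {p_{i+1}, …, p_M}, plaquette p_i)`. -/
def seamSum {N : ℕ} (ρ : G →* Matrix (Fin N) (Fin N) ℂ) (β : ℝ) (S R : ℕ) [NeZero S] (Φ : GaugeConfig 4 S G → ℝ) :
    List (Plaquette 4 S) → ℝ
  | [] => 0
  | p :: l => seamInfluence ρ β S R l.toFinset p Φ + seamSum ρ β S R Φ l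

end Seam

/-! ## §2 The renormalised family product and the quantitative letter -/

section Letter

variable {G : Type} [Group G] [TopologicalSpace G] [IsTopologicalGroup G] [CompactSpace G] [MeasurableSpace G] [BorelSpace G]

/-- The integrand common to the torus and free-cube swap Gram pairings of a reflected family at step `k`:
`Y_k(F)(Σ Ũ) · Y_k(F)(Ũ)` (`Σ = configPerm (swap 0 1)`, `Ũ = torusLift (side k) U`). -/
def swapProduct (r : LatticeRep G) (sch : SpeciesScheme (YMSpecies G)) (F : ReflectedFamily) (k : ℕ)
    (U : GaugeConfig 4 (sch.side k) G) : ℝ :=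
  famObs r sch F k (torusLift (sch.side k) (configPerm (Equiv.swap (0 : Fin 4) 1) U)) *
    famObs r sch F k (torusLift (sch.side k) U)

/-- **THE QUANTITATIVE DOOR-C LETTER `SeamInfluenceDecay r sch R m`** (p-C2): exponential decay, at PHYSICAL rate `m > 0`, of the
one-plaquette boundary influence of every seam plaquette on the renormalised swap product of every reflected family with pairwise
disjoint supports, UNIFORMLY over the intermediate boundary conditions `A ⊆ seam`: for some `K, D` (physical support radius) and `P`
(renormalisation growth exponent) depending on the family, eventually in `k`,
`|influence_k(A, p)| ≤ K · (a_k⁻¹)^P · exp(−m (a_k R_k − D))`.  Located, finite-`k`, strictly stronger than `CubeDecoupling`. -/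
def SeamInfluenceDecay (r : LatticeRep G) (sch : SpeciesScheme (YMSpecies G)) (R : ℕ → ℕ) (m : ℝ) : Prop :=
  0 < m ∧ ∀ F : ReflectedFamily,
    (∀ i (j j' : Fin (F.n i)), j ≠ j' →
      Disjoint (tsupport (F.f i j : EuclideanSpace ℝ (Fin 4) → ℝ)) (tsupport (F.f i j' : EuclideanSpace ℝ (Fin 4) → ℝ))) →
    ∃ (K D : ℝ) (P : ℕ), ∀ᶠ k in atTop, ∀ (A : Finset (Plaquette 4 (sch.side k))) (p : Plaquette 4 (sch.side k)),
      A ⊆ seam (sch.side k) (R k) → p ∈ seam (sch.side k) (R k) → p ∉ A →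
        |seamInfluence r.ρ (sch.β k) (sch.side k) (R k) A p (swapProduct r sch F k)| ≤
          K * (sch.a k)⁻¹ ^ P * Real.exp (-(m * (sch.a k * R k - D)))

end Letter

end Summit.QuantumFields.YangMills.Cruxes.DiagonalMirrorRPR.CubeSurgery

end
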